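import Summits.PneNP.PneNP.Theorems.SoloBlindCollapseSearch
import Summits.PneNP.PneNP.Theorems.SoloBlindStreamingNerode
import HarnessLib

/-!
# Canonical Myhill–Nerode representatives under the collapse (tool for THEOREM E♯)

Support file for the kernel form of THEOREM E♯ of the solo report (under `NP ⊆ P` every language
of `P` has one polynomial-time one-pass streaming algorithm whose state stays within `O(log N)`
bits of the logarithm of its Myhill–Nerode class count).  Step 1 of the construction: if `NP ⊆ P`
and `L ∈ P`, then

* `CReps.codeFP_clsTest` — one-pass equivalence `y ∈ cls L N p` (`SoloBlindStreamingNerode.lean`;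
  a `Π₁` statement about completions `z`) is a polynomial-time test on the padded code
  `⟨1ᴺ, p, y⟩` (`Collapse.polyForall`);
* `CReps.exists_rep` — there is a polynomial-time CANONICAL REPRESENTATIVE map `rep N p ∈ cls L N p`,
  constant on each class (`Collapse.search`: the tree's search-to-decision procedure is canonical
  on fibres);
* `CReps.repSet rep N i` — the finite set of canonical representatives of length `i`, with
  `|repSet| ≤ 2ⁱ` and `|repSet| ≤ |R|` for every set `R` meeting all classes of length-`i` prefixes
  (so `≤ 2^{m N}` under the class-count hypothesis of THEOREM E♯), and `CReps.codeFP_isRep` — being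
  a canonical representative is a polynomial-time test.

All padded codes start with `1ᴺ`, so that "polynomial in the code length" covers searches over
words of length `≤ N`.  All statements proved; hypotheses displayed (`NP ⊆ P`, `L ∈ P`).

References: S. Arora, B. Barak, *Computational Complexity: A Modern Approach*, CUP 2009, Thm. 2.18
(search reduces to decision under `P = NP`), §5.2 (collapse of the hierarchy); J. E. Hopcroft,
J. D. Ullman, *Introduction to Automata Theory, Languages, and Computation* (1979), §3.4.
-/

namespace Summit.PneNP.PneNP.Theorems.SoloBlind

open Polynomial
open Literature.Computability.Complexity
open Literature.Computability.Complexity.CodeFP (natE unE bitE pairE rawE strE pairE_apply length_unE)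

namespace CReps

variable {L : Language Bool}

/-! ### The class test -/

/-- Reading of the inner Boolean test of the class predicate. [folklore] -/
theorem clsInner_iff (L : Language Bool) (N : ℕ) (p y z : List Bool) :
    (!decide (p.length + z.length = N) || (L.boolIndicator (p ++ z) == L.boolIndicator (y ++ z))) =
        true ↔ (p.length + z.length = N → (p ++ z ∈ L ↔ y ++ z ∈ L)) := by
  have e1 : p ++ z ∈ L ↔ L.boolIndicator (p ++ z) = true := Set.mem_iff_boolIndicator _ _
  have e2 : y ++ z ∈ L ↔ L.boolIndicator (y ++ z) = true := Set.mem_iff_boolIndicator _ _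
  rw [e1, e2]
  cases L.boolIndicator (p ++ z) <;> cases L.boolIndicator (y ++ z) <;>
    simp [-Bool.not_eq_true]

open scoped Classical in
/-- **The one-pass class predicate is polynomial time under the collapse**: on padded codes
`⟨1ᴺ, p, y⟩`, `[y ∈ cls L N p]` is a `CodeFP` test (`NP ⊆ P`, `L ∈ P`).
[cite: AroraBarak2009, Thm. 5.4 and §5.2 (PH collapses to P)] -/
theorem codeFP_clsTest (hNP : Nondeterministic.NP ⊆ Classes.P) (hL : L ∈ Classes.P) :
    CodeFP (pairE unE (pairE strE strE)) bitE
      (fun a => decide (a.2.2 ∈ NerodeStream.cls L a.1 a.2.1)) := by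
  classical
  have hN : CodeFP (pairE (pairE unE (pairE strE strE)) strE) natE (fun t => t.1.1) :=
    CodeFP.natOfUn.comp (CodeFP.fst _ _).fst'
  have hp : CodeFP (pairE (pairE unE (pairE strE strE)) strE) strE (fun t => t.1.2.1) :=
    (CodeFP.fst _ _).snd'.fst'
  have hy : CodeFP (pairE (pairE unE (pairE strE strE)) strE) strE (fun t => t.1.2.2) :=
    (CodeFP.fst _ _).snd'.snd'
  have hz : CodeFP (pairE (pairE unE (pairE strE strE)) strE) strE (fun t => t.2) := CodeFP.snd _ _
  have hlen : CodeFP (pairE (pairE unE (pairE strE strE)) strE) bitE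
      (fun t => decide (t.1.2.1.length + t.2.length = t.1.1)) :=
    CodeFP.natEq.comp ((CodeFP.natAdd.comp ((CodeFP.strNatLength.comp hp).pair
      (CodeFP.strNatLength.comp hz))).pair hN)
  have hm₁ : CodeFP (pairE (pairE unE (pairE strE strE)) strE) bitE
      (fun t => L.boolIndicator (t.1.2.1 ++ t.2)) :=
    (Collapse.indicator hL).comp (CodeFP.strAppend.comp (hp.pair hz))
  have hm₂ : CodeFP (pairE (pairE unE (pairE strE strE)) strE) bitE
      (fun t => L.boolIndicator (t.1.2.2 ++ t.2)) :=
    (Collapse.indicator hL).comp (CodeFP.strAppend.comp (hy.pair hz))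
  have hinner : CodeFP (pairE (pairE unE (pairE strE strE)) strE) bitE
      (fun t => !decide (t.1.2.1.length + t.2.length = t.1.1) ||
        (L.boolIndicator (t.1.2.1 ++ t.2) == L.boolIndicator (t.1.2.2 ++ t.2))) :=
    hlen.not.or ((CodeFP.beq CodeFP.bitE_injective).comp (hm₁.pair hm₂))
  have hall := Collapse.polyForall hNP hinner X
  have hlen₀ : CodeFP (pairE unE (pairE strE strE)) bitE
      (fun a => decide (a.2.1.length = a.2.2.length)) :=
    CodeFP.natEq.comp ((CodeFP.strNatLength.comp (CodeFP.snd _ _).fst').pair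
      (CodeFP.strNatLength.comp (CodeFP.snd _ _).snd'))
  refine (hlen₀.and hall).congr fun a => ?_
  obtain ⟨N, p, y⟩ := a
  rw [← Bool.decide_and]
  refine decide_eq_decide.mpr ?_
  rw [NerodeStream.mem_cls_iff]
  refine and_congr Iff.rfl ⟨fun h z hz => ?_, fun h z _ => (clsInner_iff L N p y z).2 (h z)⟩
  have hzb : z.length ≤ X.eval (pairE unE (pairE strE strE) (N, p, y)).length := by
    rw [eval_X, pairE_apply, length_boolPair, length_unE]
    omega
  exact (clsInner_iff L N p y z).1 (h z hzb) hz

/-! ### Canonical representatives -/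

open scoped Classical in
/-- **Canonical representatives under the collapse.** If `NP ⊆ P` and `L ∈ P`, some polynomial-time
map on padded codes `⟨1ᴺ, p⟩ ↦ rep N p` picks a member of the class of `p` depending only on the
class. [cite: AroraBarak2009, Thm. 2.18 (search-to-decision); Thm. 5.4] -/
theorem exists_rep (hNP : Nondeterministic.NP ⊆ Classes.P) (hL : L ∈ Classes.P) :
    ∃ rep : ℕ → List Bool → List Bool, CodeFP (pairE unE strE) strE (fun a => rep a.1 a.2) ∧
      (∀ N p, rep N p ∈ NerodeStream.cls L N p) ∧
      (∀ N p p', p' ∈ NerodeStream.cls L N p → rep N p' = rep N p) := by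
  have htest : CodeFP (pairE (pairE unE strE) strE) bitE
      (fun t => decide (t.2 ∈ NerodeStream.cls L t.1.1 t.1.2)) :=
    (codeFP_clsTest hNP hL).comp ((CodeFP.fst _ _).fst'.pair ((CodeFP.fst _ _).snd'.pair
      (CodeFP.snd _ _)))
  obtain ⟨g, hgC, hgood, hcanon⟩ := Collapse.search hNP htest X
  refine ⟨fun N p => g (N, p), hgC, fun N p => ?_, fun N p p' hp' => ?_⟩
  · have hex : ∃ y : List Bool, y.length ≤ X.eval (pairE unE strE (N, p)).length ∧
        decide (y ∈ NerodeStream.cls L (N, p).1 (N, p).2) = true :=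
      ⟨p, by simp only [eval_X, pairE_apply, length_boolPair, CodeFP.strE, id_eq]; omega,
        decide_eq_true NerodeStream.mem_cls_self⟩
    exact of_decide_eq_true (hgood (N, p) hex).2
  · refine (hcanon (N, p) (N, p') ?_ fun y => decide_eq_decide.mpr ?_).symm
    · simp only [pairE_apply, length_boolPair, CodeFP.strE, id_eq,
        NerodeStream.length_eq_of_mem_cls hp']
    · exact ⟨fun h => NerodeStream.mem_cls_trans (NerodeStream.mem_cls_symm hp') h,
        fun h => NerodeStream.mem_cls_trans hp' h⟩

/-! ### The set of canonical representatives of one length -/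

/-- The canonical representatives of length `i` at input length `N` (a finite set: the fixed
points of `rep N` among the words of length `i`). [Hopcroft–Ullman 1979, §3.4] [folklore] -/
noncomputable def repSet (rep : ℕ → List Bool → List Bool) (N i : ℕ) : Finset (List Bool) :=
  ((Finset.univ : Finset (Fin i → Bool)).image List.ofFn).filter fun y => rep N y = y

variable {rep : ℕ → List Bool → List Bool}

/-- Membership in `repSet`: words of length `i` fixed by `rep N`. [folklore] -/
theorem mem_repSet {N i : ℕ} {y : List Bool} : y ∈ repSet rep N i ↔ y.length = i ∧ rep N y = y := by
  simp only [repSet, Finset.mem_filter, Finset.mem_image, Finset.mem_univ, true_and]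
  constructor
  · rintro ⟨⟨f, rfl⟩, h⟩
    exact ⟨List.length_ofFn, h⟩
  · rintro ⟨hlen, h⟩
    subst hlen
    exact ⟨⟨fun c => y[c], List.ofFn_getElem⟩, h⟩

/-- Members of `repSet rep N i` have length `i`. [folklore] -/
theorem length_of_mem_repSet {N i : ℕ} : ∀ y ∈ repSet rep N i, y.length = i :=
  fun _ hy => (mem_repSet.1 hy).1

/-- `|repSet rep N i| ≤ 2ⁱ`. [folklore] -/
theorem card_repSet_le_two_pow (rep : ℕ → List Bool → List Bool) (N i : ℕ) :
    (repSet rep N i).card ≤ 2 ^ i :=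
  calc (repSet rep N i).card ≤ ((Finset.univ : Finset (Fin i → Bool)).image List.ofFn).card :=
      Finset.card_filter_le _ _
    _ ≤ (Finset.univ : Finset (Fin i → Bool)).card := Finset.card_image_le
    _ = 2 ^ i := by simp

/-- **Class-count bound**: if `rep` is canonical and `R` meets every class of length-`i` prefixes,
then `|repSet rep N i| ≤ |R|`. [Hopcroft–Ullman 1979, §3.4] [folklore] -/
theorem card_repSet_le_of_cover {N i : ℕ}
    (hR2 : ∀ N p p', p' ∈ NerodeStream.cls L N p → rep N p' = rep N p)
    {R : Finset (List Bool)} (hcov : ∀ p : List Bool, p.length = i → ∃ r ∈ R, r ∈ NerodeStream.cls L N p) :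
    (repSet rep N i).card ≤ R.card := by
  classical
  calc (repSet rep N i).card ≤ (R.image (rep N)).card := Finset.card_le_card fun y hy => ?_
    _ ≤ R.card := Finset.card_image_le
  obtain ⟨hlen, hfix⟩ := mem_repSet.1 hy
  obtain ⟨r, hrR, hr⟩ := hcov y hlen
  exact Finset.mem_image.2 ⟨r, hrR, by rw [hR2 N y r hr, hfix]⟩

/-- A canonical representative is a fixed point: `rep N (rep N p) = rep N p`. [folklore] -/
theorem rep_rep (hR1 : ∀ N p, rep N p ∈ NerodeStream.cls L N p)
    (hR2 : ∀ N p p', p' ∈ NerodeStream.cls L N p → rep N p' = rep N p) (N : ℕ) (p : List Bool) :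
    rep N (rep N p) = rep N p :=
  hR2 N p (rep N p) (hR1 N p)

/-- The canonical representative of `p` lies in `repSet rep N |p|`. [folklore] -/
theorem rep_mem_repSet (hR1 : ∀ N p, rep N p ∈ NerodeStream.cls L N p)
    (hR2 : ∀ N p p', p' ∈ NerodeStream.cls L N p → rep N p' = rep N p) (N : ℕ) (p : List Bool) :
    rep N p ∈ repSet rep N p.length :=
  mem_repSet.2 ⟨NerodeStream.length_eq_of_mem_cls (hR1 N p), rep_rep hR1 hR2 N p⟩

/-- **Being a canonical representative is polynomial time** (on padded codes `⟨1ᴺ, 1ⁱ, y⟩`), for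
a polynomial-time `rep`. [cite: AroraBarak2009, §1.3] -/
theorem codeFP_isRep (hrepC : CodeFP (pairE unE strE) strE (fun a => rep a.1 a.2)) :
    CodeFP (pairE unE (pairE unE strE)) bitE
      (fun t => decide (t.2.2.length = t.2.1 ∧ rep t.1 t.2.2 = t.2.2)) := by
  have hy : CodeFP (pairE unE (pairE unE strE)) strE (fun t => t.2.2) := (CodeFP.snd _ _).snd'
  have h1 : CodeFP (pairE unE (pairE unE strE)) bitE (fun t => decide (t.2.2.length = t.2.1)) :=
    CodeFP.natEq.comp ((CodeFP.strNatLength.comp hy).pair (CodeFP.natOfUn.comp (CodeFP.snd _ _).fst'))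
  have h2 : CodeFP (pairE unE (pairE unE strE)) bitE (fun t => decide (rep t.1 t.2.2 = t.2.2)) :=
    (CodeFP.eq (eα := strE) Function.injective_id).comp ((hrepC.comp ((CodeFP.fst _ _).pair hy)).pair hy)
  exact (h1.and h2).congr fun t => (Bool.decide_and _ _).symm

/-- Membership in `repSet` as the polynomial-time test. [folklore] -/
theorem mem_repSet_iff_test {N i : ℕ} {y : List Bool} :
    y ∈ repSet rep N i ↔ decide (y.length = i ∧ rep N y = y) = true := by
  rw [mem_repSet, decide_eq_true_iff]

end CReps

end Summit.PneNP.PneNP.Theorems.SoloBlind
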